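import Summits.MatrixMultiplication.MatrixMultiplication.Theses.CondensationDistance
import Summits.MatrixMultiplication.MatrixMultiplication.Theorems.CondensationDistanceCondensationSound
import Summits.MatrixMultiplication.MatrixMultiplication.Theorems.CondensationDistanceDerivationsBoundOmega
import Summits.MatrixMultiplication.MatrixMultiplication.Theorems.CondensationDistanceTransportToTight
import Summits.MatrixMultiplication.MatrixMultiplication.Theorems.CondensationDistanceTightToShort

/-!
# `ShortCondensation` is summit-strength (crux-strategist r1, stmt-MatrixMultiplication-15936)

Route `MatrixMultiplication/CondensationDistance`, deciding theorem
`closes : ShortCondensation → CondensationSound → DerivationsBoundOmega → MatrixMultiplication`.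
Both companion cruxes are now LANDED theorems of the tree
(`CondensationSound_of`, stmt-15939, and `DerivationsBoundOmega_of`, stmt-15940), so the one open crux
`X := ShortCondensation` implies the summit `S := MatrixMultiplication` (ω(ℂ) = 2) OUTRIGHT, and so does
every registered sufficient condition for it: the engine `stub_schurFrame` of line `schur`
(via the landed `shortCondensation_of_schurFrame`), the support items `TightCondensation` (stmt-15937, via
`TightToShort_proof`) and `CheapHalfTransport` (stmt-15938, via `TransportToTight_proof`).

This is the theorem that makes the crux summit-strength in the sense of the strategist protocol: any
line / stub set for `X` is a line for `ω = 2` itself, and a decomposition `X₁ → … → X_k → X` whose pieces are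
each strictly weaker than `S` would be a decomposition of the summit.  (The converse `S → X` is NOT claimed and
is believed false in spirit: `X` is `ω = 2` inside the restricted Plücker/condensation model.)  Sorry-free.
-/

set_option linter.dupNamespace false

namespace Summit.MatrixMultiplication.MatrixMultiplication.Cruxes.ShortCondensation.StrategistR1

open Summit.MatrixMultiplication.MatrixMultiplication.Theses.CondensationDistance
open Summit.MatrixMultiplication.MatrixMultiplication.Theorems.ShortCondensation
open Summit.MatrixMultiplication.MatrixMultiplication.Theorems.CondensationSound (CondensationSound_of)
open Summit.MatrixMultiplication.MatrixMultiplication.Theorems.DerivationsBoundOmega (DerivationsBoundOmega_of)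

/-- **Summit strength of the crux.** `ShortCondensation → MatrixMultiplication`, by the route's deciding
theorem `closes` fed with the two landed cruxes `CondensationSound_of` (BCS 1997 (4.4)/(4.7), three-term
Plücker relations as division steps) and `DerivationsBoundOmega_of` (BCS 1997 Thm. (16.7) + Andrews lifting).
[cite: BurgisserClausenShokrollahi1997, Thm. (16.7)] -/
theorem shortCondensation_implies_summit (hX : ShortCondensation) : _root_.MatrixMultiplication :=
  closes hX CondensationSound_of DerivationsBoundOmega_of

/-- `TightCondensation → MatrixMultiplication` (support item stmt-15937 is summit-strength too). [folklore] -/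
theorem tightCondensation_implies_summit (h : TightCondensation) : _root_.MatrixMultiplication :=
  shortCondensation_implies_summit (TightToShort_proof h)

/-- `CheapHalfTransport → MatrixMultiplication` (support item stmt-15938 is summit-strength too). [folklore] -/
theorem cheapHalfTransport_implies_summit (h : CheapHalfTransport) : _root_.MatrixMultiplication :=
  tightCondensation_implies_summit (TransportToTight_proof h)

/-- **The engine of line `schur` is summit-strength**: the statement of `stub_schurFrame`
(the Schur sub-ball of `H_{n/2}` in `≤ n^(2+ε)` listed sets) implies `ω(ℂ) = 2`, via the landed
`shortCondensation_of_schurFrame`.  Hence no stub set for `stub_schurFrame` can consist of pieces each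
strictly weaker than the summit unless it is a decomposition of `ω = 2` itself. [folklore] -/
theorem schurFrame_implies_summit
    (h₁ :
    ∀ ε : ℝ, 0 < ε → ∃ n₀ : ℕ, ∀ n ≥ n₀, ∃ (l : ℕ) (f : Fin l → Finset (Fin (n + n))), (l : ℝ) ≤ (n : ℝ) ^ (2 + ε) ∧ (∀ i : Fin l, ∃ p ∈ f i, ∃ q ∈ f i, p ≠ q ∧ ∃ u ∉ f i, ∃ v ∉ f i, u ≠ v ∧ ∀ J ∈ [insert u ((f i).erase p), insert v ((f i).erase p), insert u ((f i).erase q), insert v ((f i).erase q), insert u (insert v (((f i).erase p).erase q))], (J.card = n ∧ (J.filter fun x : Fin (n + n) => n ≤ x.val).card ≤ 1) ∨ ∃ j : Fin l, j < i ∧ f j = J) ∧ ∀ J : Finset (Fin (n + n)), J.card = n → (J \ (Finset.univ.filter fun x : Fin (n + n) => n / 2 ≤ x.val ∧ x.val < n + n / 2)).card ≤ 1 → (∀ x : Fin (n + n), n ≤ x.val → x.val < n + n / 2 → x ∈ J) → (∀ x ∈ J, n / 2 ≤ x.val) → (J.card = n ∧ (J.filter fun x : Fin (n + n) => n ≤ x.val).card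 ≤ 1) ∨ ∃ i : Fin l, f i = J) :
    _root_.MatrixMultiplication :=
  shortCondensation_implies_summit (shortCondensation_of_schurFrame h₁)

/-- The three remaining open items of the route are linearly ordered by implication and all sit at or
above the summit: `CheapHalfTransport → TightCondensation → ShortCondensation → MatrixMultiplication`. -/
theorem open_items_chain :
    (CheapHalfTransport → TightCondensation) ∧ (TightCondensation → ShortCondensation) ∧
      (ShortCondensation → _root_.MatrixMultiplication) :=
  ⟨TransportToTight_proof, TightToShort_proof, shortCondensation_implies_summit⟩

end Summit.MatrixMultiplication.MatrixMultiplication.Cruxes.ShortCondensation.StrategistR1
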